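import Summits.Schanuel.Schanuel.Theses.DiophantineDichotomy
import Literature.NumberTheory.Transcendental.NesterenkoElimination

/-!
# Line `arithmetic-chardin-philippon` — crux `DiophantineDichotomy.ApproximationProperty` (stmt-Schanuel-6117)

Skeleton of the line (crux-plan, `planner-cruxplan-stmt-Schanuel-6117-arithmetic-chardin-p-0`, 2026-08-16) for
the triaged crux idea `arithmetic-chardin-philippon` (crux-ideate r1 ideator 1; triage r1: 3 × pass; sharpens
T1 "first new stub = the dim-0 complete-intersection deficit bound", T2 (toy lemma hygiene, n/a here), T3 "state
the target lemma with the liaison error explicit", panel: "AP1(3,0) in print is a BARE cycle — extraction needs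
CONSTRUCTION DATA", "currency lifting from Philippon's projective `(d(α), h(α))`, never a per-coordinate
`LiftingStep`").

THE CRUX. `ApproximationProperty` = the pointwise, affine, `(d, log H)`-currency form of Philippon's
approximation property AP2 in transcendence degree `t` (NP2001 Ch. 4 §4 p. 61; `t ≤ 2` in print, `t ≥ 3` open).

THE LINE (module map; every statement below the crux is written in the tree's NESTERENKO LANGUAGE
`Literature.NumberTheory.Transcendental.Nesterenko`: `Rx m = ℚ[x₀,…,x_m]`, a `ℚ`-subvariety / `ℚ`-cycle of
`ℙ^m` of projective dimension `r − 1` = a homogeneous ideal `I` with `IsUnmixedOfRank I r`, its degree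
`ideg I r`, height `iheight I r` and value `iabs I r ω = |I(ω)|` at `ω ∈ ℂ^{m+1}` read off the Chow form
(LNM 1752 Ch. 3 §4; Props 4.4/4.7/4.11/4.13 and Cor 4.12 are PROVED in the tree), `projDist`, `projZeros`;
the point `θ ∈ ℂ^m` sits in the affine chart `ω = (1 : θ) = Fin.cons 1 θ`):

1. `stub_arithHilbertLB` — THE LEVER (XL, OPEN, hardest; Philippon IJNT 2011 §1: "le seul obstacle … est
   l'obtention d'une minoration effective de la fonction de Hilbert arithmétique"). The ARITHMETIC twin of
   Chardin–Philippon's geometric lower bound, at EQUATION degree and EQUATION height, height-sensitive, in the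
   currency the descent consumes: for a homogeneous prime `𝔭 ⊂ ℚ[x₀..x_m]` of projective dimension `r − 1`
   (`1 ≤ r ≤ m`) which is an ISOLATED COMPONENT of hypersurfaces `g₁ = … = g_k = 0` (any `k`; `𝔭` a minimal
   prime of `(g)`) with `deg gⱼ ≤ δ₀` and integer coefficients `|gⱼ| ≤ e^T`, for every degree
   `δ ≥ max(m δ₀, 2(m+1))` and every box height `T ≥ h(𝔭)/deg(𝔭)`:
   `log N(𝔭; δ, T) ≥ (2/c)(T·deg 𝔭 + δ·h(𝔭))·δ^{r−1} − c'·deg(𝔭)·δ^{r}`,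
   where `N(𝔭; δ, T) = #{residues mod 𝔭 of integer forms of degree δ and height ≤ e^T}` (the "relative box"
   count; `c, c'` depend on `m` only). `T → ∞` recovers the geometric bound; `T = h/deg` is the arithmetic
   Hilbert–Samuel main term `h(𝔭)δ^{dim+1}` with the right sign, uniformly from `δ = mδ₀` on.
2. `stub_geomHilbertLB` — Chardin–Philippon's GEOMETRIC lower bound (KNOWN: J. Algebraic Geom. 1999 =
   Philippon 2011 Lemme 3; L–XL to formalise, or derivable from STUB 1 as its `T → ∞` shadow):
   `deg(𝔭)·δ^{r−1} ≤ c·H_g(𝔭; δ)` for the same isolated components and `δ ≥ max(mδ₀, 2(m+1))`; the matching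
   UPPER bound `H_g(𝔭; δ) ≤ deg 𝔭 ((r−1)δ+1)^{r−1}` is the tree's `Nesterenko.hilbert_le_of_isPrime`.
3. `stub_cycleAP_of_arithHilbertLB` — THE TEMPLATE (XL; Philippon 2011 Props 4/6 + Remarque run
   ARITHMETICALLY): STUB 1 ∧ STUB 2 ⟹ the 0-CYCLE approximation property WITH CONSTRUCTION DATA at every
   `θ ∈ ℂ^m`, `trdeg_ℚ ℚ(θ) ≤ t`, `1 ≤ t`: for `Y ≥ Δ ≥ c(θ)` a `ℚ`-cycle `I` of dimension 0 whose every component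
   is an ISOLATED point of `V(f₁,…,f_k)` for forms `fᵢ` of degrees `≤ cΔ` (the cutting forms of the descent,
   the equations of the locus of `θ` among them), with `deg I ≤ (cΔ)^t`, `h(I) ≤ cYΔ^{t−1}`,
   `log|I(1:θ)| ≤ −(h(I)Δ + deg I·Y)/c` (= Philippon's conjectural `Σ_{α∈Z} log Dist(θ,α)` form, IJNT 2011
   p. 2, up to `O(m·deg)`). The descent runs in `ℙ^t` after a Noether projection of the locus of `θ`
   (X₀ = ℙ^t, Philippon's degree-balance Remarque available) or inside the locus; each step = pigeonhole on
   the `N(Y; δ, T)` residues (STUB 1 for the container `Y`, an isolated component of `V_i`) giving an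
   integer form `H ∉ I(Y)` of height `≤ 2e^T`, `log ‖H‖_ω ≤ T + log 2N_δ − ½ log N(Y;δ,T)`, then the tree's
   Cor 4.12 / Prop 4.7 (metric Bézout + components); avoidance of the components of `X_i` by counting.
4. `stub_extraction` — cycle → POINT (XL, OPEN for `t ≥ 3` in print, FOREIGN: the lever of the sibling
   cards `orbit-interpolation-determinant` / `cluster-killing-own-level` / `orbit-concentration`): from the
   0-cycle property with construction data at `θ` to AP2 at `θ` in Nesterenko's currency — a prime 𝔭 of
   rank 1 (a Galois orbit) and a zero `β` with `deg 𝔭 ≤ (cΔ)^t`, `h(𝔭) ≤ cYΔ^{t−1}`,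
   `log Dist((1:θ), β) ≤ −(h(𝔭)Δ + deg 𝔭·Y)/c`. Cycle → orbit is Prop 4.7 (proved); orbit → point WITHOUT the
   `1/deg 𝔭` loss of Prop 4.13 is the open step; the construction data give interpolation degree
   `≤ t(cΔ − 1) + 1` (Chardin–Philippon regularity), which is what `SharpClosestPoint` (SketchIdeator2) eats.
5. `stub_currency` — CURRENCY LIFTING (L, provable now): AP2 at `(1:θ)` in Nesterenko's currency for all
   `m ≥ 1` ⟹ the typed crux: reindex `ι ≃ Fin m` (`ι = ∅` trivial), `γᵢ = β_{i+1}/β₀`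
   (`affine_near_of_projDist_le`), `[ℚ(γ):ℚ] = deg 𝔭`, naive heights `log H ≤ h(𝔭) + O(deg 𝔭)` (Chow form of a
   rank-1 prime = product of conjugate linear forms; Mahler/Gelfond), `Δ ≤ Y` absorbs `deg·log 2`; the
   constant picks up `log⁺‖θ‖` exactly as Disproof §2 forces.

`ApproximationProperty_of` composes the five stubs into the crux BY NAME (kernel-checked, no `sorry` outside
`stub_*`); `cycleAP_of_lever` is the kernel-checked REACH of the line without the foreign stub (STUBS 1–3 ⟹
the 0-cycle property with construction data at every point, all `t`).

## Disproof used (`Cruxes/ApproximationProperty/Disproof.lean` v5, 2026-08-16T02:21Z, rc0, 0 sorry)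
* §1 `approximationProperty_false_without_pos_t` (`1 ≤ t` load-bearing) — HONOURED: every native statement
  carries `1 ≤ t`; the line USES it in `stub_cycleAP_of_arithHilbertLB` (the descent has `trdeg ≥ 1` genuine
  cuts; for `trdeg = 0` the cycle is the orbit of `θ` itself) and in `stub_currency` (`(cΔ)^t ≥ cΔ` absorbs
  `deg·log 2` only for `t ≥ 1`).
* §2 `approximationProperty_uniform_false` (no `θ`-uniform constant in the affine currency) — HONOURED: STUBS
  1–2 are uniform in `m` only because they are PROJECTIVE statements about `ℚ`-varieties; STUBS 3–4 have
  `c = c(θ)` (locus of `θ`, `log⁺‖θ‖`); `stub_currency` is where `‖(1:θ)‖` enters (`affine_near_of_projDist_le`).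
* §3 `not_apScaleWith_liouville` / `apScaleExponentDegOne_false` / `repulsion` (landed:
  `Theorems/ApproximationProperty/Negative/ScaleExponentLiouville.lean`) — HONOURED: every accuracy clause is
  OUTPUT-dependent, `exp(−(h·Δ + deg·Y)/c)` with the output's own `h, deg`; no stub asserts a scale-only
  exponent, so none is an instance of `scaleExponent_false`.
* §4 `apAt_of_forall_isAlgebraic` — consistent: for algebraic `θ` the native statements are satisfied by the
  orbit of `θ` (`iabs = 0`, `projDist = 0`).
* §6 `approximationProperty_false_without_trdeg` / `not_apAt_one_radicalLiouvillePair` (v6, 03:06Z: the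
  hypothesis `trdeg ℚ(θ) ≤ t` is LOAD-BEARING — exponent-1 AP fails at an explicit radical-Liouville pair of
  `ℂ²`) — HONOURED and USED: every native statement carries `trdeg ℚ(θ) ≤ t` (`TrdegLE`), and
  `stub_cycleAP_of_arithHilbertLB` uses it essentially (the descent makes exactly `t₀ = trdeg` cuts on the
  locus of `θ`; budgets in exponent `t₀ ≤ t`); §5 `radical_repulsion` is a tool for STUB 4's provers.
* Landed `Negative/Shape.lean` (`false_without_pos_t`, `false_with_uniform_constant`): no stub is an instance
  (all have `1 ≤ t`; no `∃ c ∀ θ`); pending `Negative/TrdegForcing.lean` (§5–§6): no stub drops `trdeg ≤ t`.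
  `ledger negatives --problem Schanuel`: PolarPhantoms ×2, unrelated.

## Sibling interface (Lines published 02:54Z–03:03Z)
`orbit-interpolation-determinant` consumes `CycleAPIAt t` (0-cycle AP in `ℙᵗ` at `(1:ω)`, `ω ∈ ℂᵗ`, with the
INTERPOLATION datum `H_𝔭(⌊cΔ⌋) = deg 𝔭` for every associated prime) and flags its `stub_cycleAPI_four_le`
(`t ≥ 4`) as this card's job: `cycleAP_of_lever` below at `m = t`, `θ = ω` (then `trdeg ℚ(ω) ≤ t` is free)
gives it up to the KNOWN bridge "isolated points of `V(f₁..f_k)`, `deg fᵢ ≤ δ₀`, impose independent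
conditions on forms of degree `≥ m(δ₀−1)+1`" (Chardin–Philippon regularity in dimension 0, the `r = 1`
sharpening of STUB 2) and a budget rescaling `c ↦ c'`. `cluster-killing-own-level` consumes a postulation
datum of the same kind (`CycleAPPostulated`). So STUBS 1–3 of this file are the common upstream of both
extraction lines, and STUB 4 here is their lever seen from this side.
-/

set_option linter.dupNamespace false

noncomputable section

attribute [local instance] MvPolynomial.gradedAlgebra

namespace Summit.Schanuel.Schanuel.Cruxes.ApproximationProperty.ArithmeticChardinPhilippon

open Literature.NumberTheory.Transcendental.Nesterenko

/-! ## The statements (named `Prop`s over tree declarations; the registered `stub_*` theorems restate them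
verbatim with the Nesterenko names FULLY QUALIFIED — a restating Theorems file needs only this file's two
imports and `attribute [local instance] MvPolynomial.gradedAlgebra`; `Registered.stub_*` are the name-keyed
aliases taken as hypotheses of `ApproximationProperty_of`) -/

/-- The RELATIVE BOX COUNT `N(𝔭; δ, T)`: the number of residues modulo `𝔭` of the INTEGER forms of degree
`δ` whose coefficients are bounded by `e^T` (= `log` of it is the two-parameter arithmetic Hilbert function
of the line; for `T → ∞` it grows like `T · H_g(𝔭; δ)`, at `T ≈ h(𝔭)/deg 𝔭` its `δ`-growth is the
arithmetic Hilbert–Samuel term). Documentation constant — the stubs inline it. -/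
def boxResidueCount (m : ℕ) (𝔭 : Ideal (Rx m)) (δ : ℕ) (T : ℝ) : ℕ :=
  Set.ncard (Ideal.Quotient.mk 𝔭 '' {f : Rx m | f.IsHomogeneous δ ∧
    ∀ n, ∃ z : ℤ, f.coeff n = (z : ℚ) ∧ |(z : ℝ)| ≤ Real.exp T})

/-- STUB 1 statement — the ARITHMETIC Chardin–Philippon lower bound (the lever). -/
def ArithHilbertLB : Prop :=
  ∀ m : ℕ, 1 ≤ m → ∃ c c' : ℝ, 1 ≤ c ∧ 0 ≤ c' ∧
    ∀ (r k δ₀ δ : ℕ) (T : ℝ) (𝔭 : Ideal (Rx m)) (g : Fin k → Rx m) (e : Fin k → ℕ),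
      1 ≤ r → r ≤ m → 𝔭.IsPrime → 𝔭.IsHomogeneous (MvPolynomial.homogeneousSubmodule (Fin (m + 1)) ℚ) →
      IsUnmixedOfRank 𝔭 r →
      (∀ j, (g j).IsHomogeneous (e j) ∧ 1 ≤ e j ∧ e j ≤ δ₀ ∧
        ∀ n, ∃ z : ℤ, (g j).coeff n = (z : ℚ) ∧ |(z : ℝ)| ≤ Real.exp T) →
      𝔭 ∈ (Ideal.span (Set.range g)).minimalPrimes →
      m * δ₀ ≤ δ → 2 * (m + 1) ≤ δ → 0 ≤ T → iheight 𝔭 r ≤ T * ideg 𝔭 r →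
      2 / c * (T * (ideg 𝔭 r : ℝ) + (δ : ℝ) * iheight 𝔭 r) * (δ : ℝ) ^ (r - 1)
          - c' * (ideg 𝔭 r : ℝ) * (δ : ℝ) ^ r ≤
        Real.log (Set.ncard (Ideal.Quotient.mk 𝔭 '' {f : Rx m | f.IsHomogeneous δ ∧
          ∀ n, ∃ z : ℤ, f.coeff n = (z : ℚ) ∧ |(z : ℝ)| ≤ Real.exp T}) : ℝ)

/-- STUB 2 statement — Chardin–Philippon's GEOMETRIC lower bound for the Hilbert function of an isolated
component at equation degree (`H_g(𝔭; δ) = dim ℚ[x]_δ − dim 𝔭_δ`, `𝔭_δ = 𝔭 ∩ ℚ[x]_δ`, definitionally the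
tree's `Literature.RingTheory.MvPolynomial.idealDegree 𝔭 δ`). -/
def GeomHilbertLB : Prop :=
  ∀ m : ℕ, 1 ≤ m → ∃ c : ℝ, 1 ≤ c ∧
    ∀ (r k δ₀ δ : ℕ) (𝔭 : Ideal (Rx m)) (g : Fin k → Rx m) (e : Fin k → ℕ),
      1 ≤ r → r ≤ m → 𝔭.IsPrime → 𝔭.IsHomogeneous (MvPolynomial.homogeneousSubmodule (Fin (m + 1)) ℚ) →
      IsUnmixedOfRank 𝔭 r →
      (∀ j, (g j).IsHomogeneous (e j) ∧ 1 ≤ e j ∧ e j ≤ δ₀) →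
      𝔭 ∈ (Ideal.span (Set.range g)).minimalPrimes →
      m * δ₀ ≤ δ → 2 * (m + 1) ≤ δ →
      (ideg 𝔭 r : ℝ) * (δ : ℝ) ^ (r - 1) ≤
        c * ((Module.finrank ℚ ↥(MvPolynomial.homogeneousSubmodule (Fin (m + 1)) ℚ δ) : ℝ) -
          (Module.finrank ℚ ↥(Submodule.restrictScalars ℚ 𝔭 ⊓
            MvPolynomial.homogeneousSubmodule (Fin (m + 1)) ℚ δ) : ℝ))

/-- The hypothesis on the point: `trdeg_ℚ ℚ(θ) ≤ t` (verbatim the crux's clause). -/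
def TrdegLE (m t : ℕ) (θ : Fin m → ℂ) : Prop :=
  Algebra.trdeg ℚ ↥(IntermediateField.adjoin ℚ (Set.range θ)) ≤ (t : Cardinal)

/-- The 0-CYCLE approximation property WITH CONSTRUCTION DATA at `θ ∈ ℂ^m`, exponent `t`: for all scales
`Y ≥ Δ ≥ c` a homogeneous unmixed ideal `I` of rank 1 (a `ℚ`-cycle of dimension 0) every associated prime of
which is a minimal prime of `(f₁, …, f_k)` for forms `fᵢ` of degrees in `[1, cΔ]` (its points are ISOLATED
points of `V(f)`), with Philippon's budgets `deg I ≤ (cΔ)^t`, `h(I) ≤ cYΔ^{t−1}` and closeness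
`|I(1:θ)| ≤ exp(−(h(I)Δ + deg I·Y)/c)` (output-dependent; `log|I(ω)| = Σ_α log Dist(ω,α) + O(m deg I)`). -/
def CycleAPAt (m t : ℕ) (θ : Fin m → ℂ) : Prop :=
  ∃ c : ℝ, 1 ≤ c ∧ ∀ Δ Y : ℝ, c ≤ Δ → Δ ≤ Y →
    ∃ (I : Ideal (Rx m)) (k : ℕ) (f : Fin k → Rx m) (e : Fin k → ℕ),
      I.IsHomogeneous (MvPolynomial.homogeneousSubmodule (Fin (m + 1)) ℚ) ∧ IsUnmixedOfRank I 1 ∧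
      (∀ i, (f i).IsHomogeneous (e i) ∧ 1 ≤ e i ∧ (e i : ℝ) ≤ c * Δ) ∧
      (∀ 𝔭 ∈ I.associatedPrimes, 𝔭 ∈ (Ideal.span (Set.range f)).minimalPrimes) ∧
      (ideg I 1 : ℝ) ≤ (c * Δ) ^ t ∧ iheight I 1 ≤ c * Y * Δ ^ (t - 1) ∧
      iabs I 1 (Fin.cons 1 θ) ≤ Real.exp (-((iheight I 1 * Δ + ideg I 1 * Y) / c))

/-- AP2 at `θ ∈ ℂ^m` in Nesterenko's currency, exponent `t`: for all scales a homogeneous PRIME `𝔭` of rank 1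
(the Galois orbit of an algebraic point of `ℙ^m`) and a zero `β` of it with `1 ≤ deg 𝔭 ≤ (cΔ)^t`,
`h(𝔭) ≤ cYΔ^{t−1}` and `Dist((1:θ), β) ≤ exp(−(h(𝔭)Δ + deg 𝔭·Y)/c)` — `d(α) = deg 𝔭`,
`d(α)h(α) = h(𝔭) + O(deg 𝔭)`, so this is NP2001 Ch. 4 §4 AP2 pointwise. -/
def PointAPAt (m t : ℕ) (θ : Fin m → ℂ) : Prop :=
  ∃ c : ℝ, 1 ≤ c ∧ ∀ Δ Y : ℝ, c ≤ Δ → Δ ≤ Y →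
    ∃ (𝔭 : Ideal (Rx m)) (β : Fin (m + 1) → ℂ),
      𝔭.IsPrime ∧ 𝔭.IsHomogeneous (MvPolynomial.homogeneousSubmodule (Fin (m + 1)) ℚ) ∧
      IsUnmixedOfRank 𝔭 1 ∧ β ∈ projZeros 𝔭 ∧ 1 ≤ ideg 𝔭 1 ∧
      (ideg 𝔭 1 : ℝ) ≤ (c * Δ) ^ t ∧ iheight 𝔭 1 ≤ c * Y * Δ ^ (t - 1) ∧
      projDist (Fin.cons 1 θ) β ≤ Real.exp (-((iheight 𝔭 1 * Δ + ideg 𝔭 1 * Y) / c))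

/-- STUB 3 statement — the TEMPLATE: lever ∧ geometric bound ⟹ 0-cycle AP with construction data at every
point, every `t ≥ max(1, trdeg)`. -/
def CycleAPOfLever : Prop :=
  ArithHilbertLB → GeomHilbertLB →
    ∀ (m t : ℕ) (θ : Fin m → ℂ), 1 ≤ m → 1 ≤ t → TrdegLE m t θ → CycleAPAt m t θ

/-- STUB 4 statement — EXTRACTION: 0-cycle AP with construction data ⟹ AP2, pointwise. -/
def Extraction : Prop :=
  ∀ (m t : ℕ) (θ : Fin m → ℂ), 1 ≤ m → 1 ≤ t → TrdegLE m t θ → CycleAPAt m t θ → PointAPAt m t θ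

/-- STUB 5 statement — CURRENCY LIFTING: AP2 in Nesterenko's currency at every `(1:θ)` ⟹ the typed crux
(conclusion = the crux's body verbatim; `ApproximationProperty_of` closes by unfolding). -/
def CurrencyLifting : Prop :=
  (∀ (m t : ℕ) (θ : Fin m → ℂ), 1 ≤ m → 1 ≤ t → TrdegLE m t θ → PointAPAt m t θ) →
    ∀ (ι : Type) [Fintype ι] (θ : ι → ℂ) (t : ℕ), 1 ≤ t →
      Algebra.trdeg ℚ ↥(IntermediateField.adjoin ℚ (Set.range θ)) ≤ (t : Cardinal) →
      ∃ c : ℝ, 1 ≤ c ∧ ∀ Δ Y : ℝ, c ≤ Δ → Δ ≤ Y → ∃ (γ : ι → ℂ) (d H : ℕ),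
        Module.finrank ℚ ↥(IntermediateField.adjoin ℚ (Set.range γ)) ≤ d ∧
        (∀ i, ∃ P : Polynomial ℤ, P ≠ 0 ∧ P.natDegree ≤ d ∧ (∀ k, |P.coeff k| ≤ (H : ℤ)) ∧
          Polynomial.aeval (γ i) P = 0) ∧
        (d : ℝ) ≤ (c * Δ) ^ t ∧ Real.log H ≤ c * Y * Δ ^ (t - 1) ∧
        ‖γ - θ‖ ≤ Real.exp (-((Real.log H * Δ + d * Y) / c))

/-! ## The registered stubs (`sorry` lives only here; signatures `let`-free with the Nesterenko names fully
qualified, so that a Theorems-side `propose --supports stmt-Schanuel-6117` proof can restate them textually) -/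

/-- **STUB 1 · `stub_arithHilbertLB`** (XL, OPEN — THE LEVER, HARDEST; Philippon's "seul obstacle").
For `m ≥ 1` there are `c ≥ 1`, `c' ≥ 0` such that for every homogeneous prime `𝔭 ⊂ ℚ[x₀,…,x_m]` with
`dim ℚ[x]/𝔭 = r ∈ [1, m]` (projective dimension `r − 1`) which is a minimal prime of an ideal generated by
integer forms `g₁,…,g_k` (any `k`) of degrees in `[1, δ₀]` and coefficients `≤ e^T` in modulus, and every
`δ ≥ max(mδ₀, 2(m+1))`, `T ≥ 0` with `h(𝔭) ≤ T·deg 𝔭`: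
`(2/c)(T·deg 𝔭 + δ·h(𝔭))·δ^{r−1} − c'·deg 𝔭·δ^r ≤ log #{residues mod 𝔭 of integer forms of degree δ with
coefficients bounded by e^T}` (`deg = ideg 𝔭 r`, `h = iheight 𝔭 r`, Chow-form degree/height of LNM 1752
Ch. 3 §4). WHY THIS SHAPE. `log N(T) ≈ T·H_g(𝔭;δ) + log covol(𝔭_δ ∩ ℤ[x]_δ)` once the box exceeds the
successive minima of the ideal lattice, and `log covol(𝔭_δ,ℤ)` IS the arithmetic Hilbert function
(Schmidt height of `𝔭_δ`; `≈ h(𝔭)δ^{dim+1}/(dim+1)!` asymptotically, David–Philippon 1999 / Liu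
arXiv:2410.12821 for hypersurfaces at `δ ≥ δ₀+1`); the statement asks for both at EQUATION degree `mδ₀`,
uniformly, with the card's error `c'·deg·δ^{dim+1}`. The two height hypotheses are NECESSARY (box
saturation): `𝔭 = (x₁^d − a x₀^d) ⊂ ℚ[x₀,x₁]` at `T < log a` has EVERY box form in a distinct residue,
`log N = (δ+1)·log(2⌊e^T⌋+1)`, below `(2/c)δ·log a` — excluded by `|gⱼ| ≤ e^T` (equation height) — and
`T ≥ h/deg` keeps the box above the binomial relations `y_k e_α − y_l e_{α'}` of a point `y`. It is the form
the template consumes: two box forms with the same value at `ω` up to `2N_δe^T/√N` and distinct residues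
differ by an integer form `H ∉ 𝔭` of height `≤ 2e^T`. FIRST MILESTONE (= triage T1, the card's falsifier
(1), ideator toy j009236): `r = 1`, `k = m`, `V(g)` a reduced 0-dimensional complete intersection — the
deficit `δ·h(V) − log covol` is a resultant/discriminant, bounded by `c_m(δ₀ h(V) + deg V·δ₀ log δ₀)`
independently of `δ`. WHY IT MIGHT FAIL: (O1) components of SMALL degree (`deg 𝔭 ≪ δ₀^{codim}`) — the natural
geometry-of-numbers proofs lose `e^{O(N_δ)}`, `N_δ = binom(δ+m, m)`, against the allowed
`c'·deg·δ^{dim+1}`; the liaison/section induction of the card must beat that; if it is false there, the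
reshape is the error term `c'(deg·δ^r + δ^m log δ)` plus degree-balanced components in STUB 3 (Philippon's
Remarque after Prop. 6: every component of `X_i` has degree `≥ (2^m c_m)^{−i} δ₁⋯δ_i` when `X₀ = ℙ^m`).
Leans on (Mathlib): `ZLattice.covolume`, Minkowski (`MeasureTheory.exists_ne_zero_mem_lattice_of_measure_mul_two_pow_lt_measure`),
`Int.Matrix.exists_ne_zero_int_vec_norm_le`, `Ideal.minimalPrimes`, `Set.ncard`; (tree) `Nesterenko.chowForm/ideg/iheight`,
`NesterenkoPhilippon2001_ch3_prop_4_4` (proved: `NesterenkoEliminationProp44Holds`), `Nesterenko.hilbert_le_of_isPrime`,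
`Roy2013.sum_mul_height_le_log_length` (Gelfond–Mahler for linear factors). [Philippon IJNT 2011
doi:10.1142/s1793042111004502 §1 + Lemme 3; Chardin–Philippon JAG 1999; Liu arXiv:2410.12821 Thm 1.2;
David–Philippon CMH 1999; Gaudron–Rémond Acta Arith 154 (2012) Thm 2.2] -/
theorem stub_arithHilbertLB : ∀ m : ℕ, 1 ≤ m → ∃ c c' : ℝ, 1 ≤ c ∧ 0 ≤ c' ∧ ∀ (r k δ₀ δ : ℕ) (T : ℝ) (𝔭 : Ideal (Literature.NumberTheory.Transcendental.Nesterenko.Rx m)) (g : Fin k → Literature.NumberTheory.Transcendental.Nesterenko.Rx m) (e : Fin k → ℕ), 1 ≤ r → r ≤ m → 𝔭.IsPrime → 𝔭.IsHomogeneous (MvPolynomial.homogeneousSubmodule (Fin (m + 1)) ℚ) → Literature.NumberTheory.Transcendental.Nesterenko.IsUnmixedOfRank 𝔭 r → (∀ j, (g j).IsHomogeneous (e j) ∧ 1 ≤ e j ∧ e j ≤ δ₀ ∧ ∀ n, ∃ z : ℤ, (g j).coeff n = (z : ℚ) ∧ |(z : ℝ)| ≤ Real.exp T) → 𝔭 ∈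 (Ideal.span (Set.range g)).minimalPrimes → m * δ₀ ≤ δ → 2 * (m + 1) ≤ δ → 0 ≤ T → Literature.NumberTheory.Transcendental.Nesterenko.iheight 𝔭 r ≤ T * Literature.NumberTheory.Transcendental.Nesterenko.ideg 𝔭 r → 2 / c * (T * (Literature.NumberTheory.Transcendental.Nesterenko.ideg 𝔭 r : ℝ) + (δ : ℝ) * Literature.NumberTheory.Transcendental.Nesterenko.iheight 𝔭 r) * (δ : ℝ) ^ (r - 1) - c' * (Literature.NumberTheory.Transcendental.Nesterenko.ideg 𝔭 r : ℝ) * (δ : ℝ) ^ r ≤ Real.log (Set.ncard (Ideal.Quotient.mk 𝔭 '' {f : Literature.NumberTheory.Transcendental.Nesterenko.Rx m | f.IsHomogeneous δ ∧ ∀ n, ∃ z : ℤ, f.coeff n = (z : ℚ) ∧ |(z : ℝ)| ≤ Real.exp T}) : ℝ) := by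
  sorry

/-- **STUB 2 · `stub_geomHilbertLB`** (L–XL, KNOWN — Chardin–Philippon, "Régularité et interpolation", J.
Algebraic Geom. 8 (1999); = Philippon IJNT 2011 Lemme 3, lower half: for `Y` incompletely defined by forms of
degree `≤ δ₀` and `δ' ≥ 2(n+1)`, `2c_n^{-1} min(1, δ'/δ₀)^{codim Y} deg(Y) δ'^{dim Y} < H_g(Y; δ')`,
`c_n = 2^{4n²+n+1}·n!`; here with `δ ≥ mδ₀` so the `min` is `1`). For `m ≥ 1` there is `c ≥ 1` with
`deg(𝔭)·δ^{r−1} ≤ c·(dim_ℚ ℚ[x]_δ − dim_ℚ(𝔭 ∩ ℚ[x]_δ))` for every homogeneous prime `𝔭` of rank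
`r ∈ [1, m]` that is a minimal prime of forms of degrees in `[1, δ₀]`, and `δ ≥ max(mδ₀, 2(m+1))`. The upper
bound companion is PROVED in the tree (`Nesterenko.hilbert_le_of_isPrime`: `≤ deg 𝔭·((r−1)δ+1)^{r−1}`). Two
discharge routes: (a) formalise Chardin–Philippon (Castelnuovo–Mumford regularity of an isolated component is
`≤ codim·(δ₀−1)+1`, whence the Hilbert function agrees with the Hilbert polynomial of a `deg 𝔭`-sheeted… in
degree `≥ mδ₀`; tree assets: `Literature.RingTheory.HilbertSamuel.*`, `ZeroEst.exists_sandwich_of_isPrime`,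
`CohenMacaulayUnmixed`); (b) derive it from STUB 1 as `T → ∞`: `log N(𝔭;δ,T) ≤ H_g(𝔭;δ)·T + O_{𝔭,δ}(1)`
by lattice-point asymptotics in the fixed residue lattice (`ZLattice.covolume.tendsto_card_le_div'`). WHY IT
MIGHT FAIL: it does not (theorem in print); formalisation size only. [Chardin–Philippon JAG 1999; Philippon
IJNT 2011 Lemme 3; Chardin, Bull. SMF 117 (1989) (upper bound)] -/
theorem stub_geomHilbertLB : ∀ m : ℕ, 1 ≤ m → ∃ c : ℝ, 1 ≤ c ∧ ∀ (r k δ₀ δ : ℕ) (𝔭 : Ideal (Literature.NumberTheory.Transcendental.Nesterenko.Rx m)) (g : Fin k → Literature.NumberTheory.Transcendental.Nesterenko.Rx m) (e : Fin k → ℕ), 1 ≤ r → r ≤ m → 𝔭.IsPrime → 𝔭.IsHomogeneous (MvPolynomial.homogeneousSubmodule (Fin (m + 1)) ℚ) → Literature.NumberTheory.Transcendental.Nesterenko.IsUnmixedOfRank 𝔭 r → (∀ j, (g j).IsHomogeneous (e j) ∧ 1 ≤ e j ∧ e j ≤ δ₀) → 𝔭 ∈ (Ideal.span (Set.range g)).minimalPrimes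 → m * δ₀ ≤ δ → 2 * (m + 1) ≤ δ → (Literature.NumberTheory.Transcendental.Nesterenko.ideg 𝔭 r : ℝ) * (δ : ℝ) ^ (r - 1) ≤ c * ((Module.finrank ℚ ↥(MvPolynomial.homogeneousSubmodule (Fin (m + 1)) ℚ δ) : ℝ) - (Module.finrank ℚ ↥(Submodule.restrictScalars ℚ 𝔭 ⊓ MvPolynomial.homogeneousSubmodule (Fin (m + 1)) ℚ δ) : ℝ)) := by
  sorry

/-- **STUB 3 · `stub_cycleAP_of_arithHilbertLB`** (XL — THE TEMPLATE: Philippon IJNT 2011 Thm 1 / Props 4, 6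
and the Remarque after Prop. 6, run ARITHMETICALLY; "ce travail se base uniquement sur [la minoration de CP
et la majoration de Chardin]"). Hypotheses: STUB 1 (arithmetic lower bound) and STUB 2 (geometric lower
bound); conclusion: for every `m ≥ 1`, `t ≥ 1`, `θ ∈ ℂ^m` with `trdeg_ℚ ℚ(θ) ≤ t`, the 0-cycle approximation
property with construction data `CycleAPAt m t θ`. THE PLAN. Let `t₀ = trdeg ℚ(θ)`; if `t₀ = 0` the orbit
of `θ` is the cycle (`|I(ω)| = 0`). Else let `X ⊂ ℙ^m` be the locus of `ω = (1:θ)` over `ℚ`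
(`Nesterenko.coneIdeal ω`, prime, `dim = t₀`; Krull dimension = trdeg + 1), `π : X → ℙ^{t₀}` a finite
linear projection over `ℚ` étale at `ω` (Noether), `φ = π(ω)` generic in `ℙ^{t₀}`. Run Philippon's Prop. 6
in `ℙ^{t₀}` with `X₀ = ℙ^{t₀}`, `d = 0`, `δ = ⌊Δ/C⌋`, boxes `T_i = C^i·Y + h(X_i)/deg X_i`: STEP = given the
container `Y` (a component of `X_i`, an isolated component of `V_i = H₁ ∩ … ∩ H_i`, so STUB 1 applies with
`gⱼ = Hⱼ`, `|Hⱼ| ≤ e^{T_i}`, and `h(Y)/deg Y ≤ T_i`) holding a good `Z`, pigeonhole the `N(Y;δ,T_i)` box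
residues on their values at `φ` (disc of radius `N_δ e^{T_i}`): two of them differ by an integer `H ∉ I(Y)`,
`|H| ≤ 2e^{T_i}`, `log‖H‖_φ ≤ T_i + log(2N_δ) − ½ log N(Y;δ,T_i) ≤ −(1/c)(T_i deg Y + δ h(Y))δ^{dim Y} + …`;
if `H ∈ I(Z)` the container shrinks for free (`Y' =` a component of `Y ∩ H` through `Z`, height `≤ (δ+1)h(Y) +
T_i deg Y`), which replaces Philippon's `H_g(Z;δ) < H_g(Y;δ)` branch, else `Z' =` a good component of `Z·H`;
avoidance of the good-carrying components `W` of `V_i` (needed for ISOLATEDNESS of the next container, Scolie 5) by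
counting (`#{box forms in one class mod I(W)} ≤ (2e^T+1)^{N_δ − H_g(W;δ)}`, STUB 2 for `H_g(W;δ)`); cut with
the tree's Cor 4.12 (`NesterenkoEliminationCor412Holds`) and pass to components with Prop 4.7
(`…Prop47Holds`): degrees `≤ δ^i`, heights `≤ C^i Y δ^{i−1}`, and the potential `h(·)Δ + deg(·)Y` of the
good sub-cycle stays `≥ (1/c)·(smallness)` because STUB 1 is HEIGHT-SENSITIVE (a small high component gets
`δ·h·δ^{dim}`) — this is exactly where the geometric count `T·H_g` alone fails. Degree balance of the
components of `X_i` from the Remarque (minimal-degree cuts; constants `2^{t}c_t`), using STUB 2 + `hilbert_le`.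
After `t₀` steps: a 0-cycle `Z' ⊂ ℙ^{t₀}` close to `φ`; LIFT along `π` (fibre cycle on `X`, degree
`× deg X`, heights `+ O_θ(deg)`, one fibre point within `O_θ(Dist(φ, α))` of `ω` by the étale chart);
construction data = the pulled-back cutting forms `Hⱼ ∘ π` together with generators of `coneIdeal ω`
(degree `O_θ(1) ≤ cΔ`). Output exponent `t₀`, then monotonicity in `t` (Disproof `apAt_mono` pattern:
`(cΔ)^{t₀} ≤ (cΔ)^t`, `Δ^{t₀−1} ≤ Δ^{t−1}`). WHY IT MIGHT FAIL: (i) AVOIDANCE VS SMALL COMPONENTS — a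
component `W` of `X_i` of tiny `H_g(W;δ)` cannot be avoided by pairs at the closeness level the big container
affords; Philippon only avoids components of `X_i` (those holding a good subvariety) and the Remarque makes
them degree-balanced when `X₀ = ℙ^{t₀}` — the projection step exists to be in that case; (ii) the lifting
along `π` must not lose the output-dependence (heights of fibre points: `h ≤ h(α) deg X + O_θ(deg)`); (iii)
`Δ ≤ Y` is used to absorb `deg·log`-losses. Uses `1 ≤ t` (Disproof §1). Leans on (tree, proved):
`NesterenkoPhilippon2001_ch3_prop_4_7/4_11/4_13`, `…cor_4_12` (`*Holds` files), `Nesterenko.coneIdeal`,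
`isPrime_coneIdeal`, `mem_projZeros_coneIdeal`, `Nesterenko.hilbert_le_of_isPrime`,
`Nesterenko.exists_isHomogeneous_mem_ne_zero_of_isPrime`; Mathlib `Algebra.trdeg`, `ringKrullDim`,
`Ideal.minimalPrimes`, `Submodule.associatedPrimes`; NOT in tree: Noether projection with an étale point,
`ringKrullDim (ℚ[x]/coneIdeal ω) = trdeg + 1`. [Philippon IJNT 2011 Thm 1, Prop 4, Prop 6 + Remarque, Cor 2;
NesterenkoPhilippon2001 Ch. 3 §4, Ch. 4 §4 p. 61 (AP1), Ch. 8 Lemma 0.7; Philippon JNT 81 (2000)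
doi:10.1006/jnth.1999.2461 (acq-02318, not held)] -/
theorem stub_cycleAP_of_arithHilbertLB : (∀ m : ℕ, 1 ≤ m → ∃ c c' : ℝ, 1 ≤ c ∧ 0 ≤ c' ∧ ∀ (r k δ₀ δ : ℕ) (T : ℝ) (𝔭 : Ideal (Literature.NumberTheory.Transcendental.Nesterenko.Rx m)) (g : Fin k → Literature.NumberTheory.Transcendental.Nesterenko.Rx m) (e : Fin k → ℕ), 1 ≤ r → r ≤ m → 𝔭.IsPrime → 𝔭.IsHomogeneous (MvPolynomial.homogeneousSubmodule (Fin (m + 1)) ℚ) → Literature.NumberTheory.Transcendental.Nesterenko.IsUnmixedOfRank 𝔭 r → (∀ j, (g j).IsHomogeneous (e j) ∧ 1 ≤ e j ∧ e j ≤ δ₀ ∧ ∀ n, ∃ z : ℤ, (g j).coeff n = (z : ℚ) ∧ |(z : ℝ)| ≤ Real.exp T) → 𝔭 ∈ (Ideal.span (Set.range g)).minimalPrimes → m * δ₀ ≤ δ → 2 * (m + 1) ≤ δ → 0 ≤ T → Literature.NumberTheory.Transcendental.Nesterenko.iheight 𝔭 r ≤ T * Literature.NumberTheory.Transcendental.Nesterenko.ideg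 𝔭 r → 2 / c * (T * (Literature.NumberTheory.Transcendental.Nesterenko.ideg 𝔭 r : ℝ) + (δ : ℝ) * Literature.NumberTheory.Transcendental.Nesterenko.iheight 𝔭 r) * (δ : ℝ) ^ (r - 1) - c' * (Literature.NumberTheory.Transcendental.Nesterenko.ideg 𝔭 r : ℝ) * (δ : ℝ) ^ r ≤ Real.log (Set.ncard (Ideal.Quotient.mk 𝔭 '' {f : Literature.NumberTheory.Transcendental.Nesterenko.Rx m | f.IsHomogeneous δ ∧ ∀ n, ∃ z : ℤ, f.coeff n = (z : ℚ) ∧ |(z : ℝ)| ≤ Real.exp T}) : ℝ)) → (∀ m : ℕ, 1 ≤ m → ∃ c : ℝ, 1 ≤ c ∧ ∀ (r k δ₀ δ : ℕ) (𝔭 : Ideal (Literature.NumberTheory.Transcendental.Nesterenko.Rx m)) (g : Fin k → Literature.NumberTheory.Transcendental.Nesterenko.Rx m) (e : Fin k → ℕ), 1 ≤ r → r ≤ m → 𝔭.IsPrime → 𝔭.IsHomogeneous (MvPolynomial.homogeneousSubmodule (Fin (m + 1)) ℚ) → Literature.NumberTheory.Transcendental.Nesterenko.IsUnmixedOfRank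 𝔭 r → (∀ j, (g j).IsHomogeneous (e j) ∧ 1 ≤ e j ∧ e j ≤ δ₀) → 𝔭 ∈ (Ideal.span (Set.range g)).minimalPrimes → m * δ₀ ≤ δ → 2 * (m + 1) ≤ δ → (Literature.NumberTheory.Transcendental.Nesterenko.ideg 𝔭 r : ℝ) * (δ : ℝ) ^ (r - 1) ≤ c * ((Module.finrank ℚ ↥(MvPolynomial.homogeneousSubmodule (Fin (m + 1)) ℚ δ) : ℝ) - (Module.finrank ℚ ↥(Submodule.restrictScalars ℚ 𝔭 ⊓ MvPolynomial.homogeneousSubmodule (Fin (m + 1)) ℚ δ) : ℝ))) → ∀ (m t : ℕ) (θ : Fin m → ℂ), 1 ≤ m → 1 ≤ t → Algebra.trdeg ℚ ↥(IntermediateField.adjoin ℚ (Set.range θ)) ≤ (t : Cardinal) → ∃ c : ℝ, 1 ≤ c ∧ ∀ Δ Y : ℝ, c ≤ Δ → Δ ≤ Y → ∃ (I : Ideal (Literature.NumberTheory.Transcendental.Nesterenko.Rx m)) (k : ℕ) (f : Fin k → Literature.NumberTheory.Transcendental.Nesterenko.Rx m) (e : Fin k → ℕ), I.IsHomogeneous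 (MvPolynomial.homogeneousSubmodule (Fin (m + 1)) ℚ) ∧ Literature.NumberTheory.Transcendental.Nesterenko.IsUnmixedOfRank I 1 ∧ (∀ i, (f i).IsHomogeneous (e i) ∧ 1 ≤ e i ∧ (e i : ℝ) ≤ c * Δ) ∧ (∀ 𝔭 ∈ I.associatedPrimes, 𝔭 ∈ (Ideal.span (Set.range f)).minimalPrimes) ∧ (Literature.NumberTheory.Transcendental.Nesterenko.ideg I 1 : ℝ) ≤ (c * Δ) ^ t ∧ Literature.NumberTheory.Transcendental.Nesterenko.iheight I 1 ≤ c * Y * Δ ^ (t - 1) ∧ Literature.NumberTheory.Transcendental.Nesterenko.iabs I 1 (Fin.cons 1 θ) ≤ Real.exp (-((Literature.NumberTheory.Transcendental.Nesterenko.iheight I 1 * Δ + Literature.NumberTheory.Transcendental.Nesterenko.ideg I 1 * Y) / c)) := by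
  sorry

/-- **STUB 4 · `stub_extraction`** (XL, OPEN for `t ≥ 3` in print — FOREIGN: the lever of the sibling cards;
AP1(d = 0) ⟹ AP2 is printed only for `n ≤ 2`, NP2001 Ch. 4 §4 p. 61). Pointwise: for `m ≥ 1`, `t ≥ 1`,
`θ ∈ ℂ^m` with `trdeg ≤ t`, the 0-cycle property with construction data `CycleAPAt m t θ` implies AP2 at
`(1:θ)` in Nesterenko's currency `PointAPAt m t θ`. CHEAP HALF (provable now): cycle → ORBIT — Prop 4.7
(tree, proved) splits `deg`, `h`, `log|·(ω)|` additively over the associated primes with exponents, and a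
pigeonhole weighted by `h(𝔭ⱼ)Δ + deg 𝔭ⱼ·Y` gives a component `𝔭` with `log|𝔭(ω)| ≤ −(h(𝔭)Δ + deg 𝔭·Y)/c₁`
(`Y ≥ Δ ≥ c₁ ≥ 2(m²+1)c` absorbs the `m² deg`, `m³ deg` losses), `deg 𝔭 ≤ deg I`, `h(𝔭) ≤ h(I) + m² deg I`.
OPEN HALF: orbit → POINT without the `1/deg 𝔭` loss of Prop 4.13 (tree, proved:
`deg 𝔭 · log Dist(ω, β) ≤ log|𝔭(ω)| + h(𝔭) + 4m³ deg 𝔭`, i.e. the AVERAGE conjugate): one conjugate must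
carry a constant fraction of the orbit's proximity. This is `SharpClosestPoint` of `orbit-interpolation-
determinant` (SketchIdeator2 §A′; interpolation hypothesis `H_𝔭(δ) = deg 𝔭`) — supplied here by the
CONSTRUCTION DATA: every point of the cycle is an isolated point of `V(f₁..f_k)`, `deg fᵢ ≤ cΔ`, so by
Chardin–Philippon regularity the orbit imposes independent conditions on forms of degree `≥ m(cΔ−1)+1`
(interpolation degree `O(Δ)`, the regime where the triagers' stress families pass); or `cluster-killing-own-
level`'s auxiliary form at the orbit's own level `D* ≍ d^{1/t}` with Liouville along the orbit; enveloped /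
clustered orbits are the named risk (triage: cheap 1-dimensional envelopes force the discriminant route).
WHY IT MIGHT FAIL: a high orbit enveloped by a cheap curve where the orbit-level supply cannot beat
Liouville's `D₀·h(Z_α)` (TRIAGE r1-3 example for the universal `C⁺`); the statement here is only the
pointwise implication at `θ`, with all scales available. Consistent with Disproof §3 (output-dependent) and
§4 (algebraic `θ`: `𝔭 = ` orbit of `θ`, `projDist = 0`). Leans on: `NesterenkoPhilippon2001_ch3_prop_4_7`,
`…_4_13` (proved), `norm_sub_root_pow_le`, `norm_det_sq_le_of_entry_le`, SketchIdeator2 `OrbitClusterBoundDim2`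
/ `SharpClosestPoint` (statements). [NesterenkoPhilippon2001 Ch. 3 Prop 4.7, 4.13, Ch. 4 §4 p. 61, Ch. 8
Cor 0.8; LaurentRoy1999 Thm 1; RoyWaldschmidt1997; Philippon JNT 2000 (acq-02318)] -/
theorem stub_extraction : ∀ (m t : ℕ) (θ : Fin m → ℂ), 1 ≤ m → 1 ≤ t → Algebra.trdeg ℚ ↥(IntermediateField.adjoin ℚ (Set.range θ)) ≤ (t : Cardinal) → (∃ c : ℝ, 1 ≤ c ∧ ∀ Δ Y : ℝ, c ≤ Δ → Δ ≤ Y → ∃ (I : Ideal (Literature.NumberTheory.Transcendental.Nesterenko.Rx m)) (k : ℕ) (f : Fin k → Literature.NumberTheory.Transcendental.Nesterenko.Rx m) (e : Fin k → ℕ), I.IsHomogeneous (MvPolynomial.homogeneousSubmodule (Fin (m + 1)) ℚ) ∧ Literature.NumberTheory.Transcendental.Nesterenko.IsUnmixedOfRank I 1 ∧ (∀ i, (f i).IsHomogeneous (e i) ∧ 1 ≤ e i ∧ (e i : ℝ) ≤ c * Δ) ∧ (∀ 𝔭 ∈ I.associatedPrimes, 𝔭 ∈ (Ideal.span (Set.range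 f)).minimalPrimes) ∧ (Literature.NumberTheory.Transcendental.Nesterenko.ideg I 1 : ℝ) ≤ (c * Δ) ^ t ∧ Literature.NumberTheory.Transcendental.Nesterenko.iheight I 1 ≤ c * Y * Δ ^ (t - 1) ∧ Literature.NumberTheory.Transcendental.Nesterenko.iabs I 1 (Fin.cons 1 θ) ≤ Real.exp (-((Literature.NumberTheory.Transcendental.Nesterenko.iheight I 1 * Δ + Literature.NumberTheory.Transcendental.Nesterenko.ideg I 1 * Y) / c))) → ∃ c : ℝ, 1 ≤ c ∧ ∀ Δ Y : ℝ, c ≤ Δ → Δ ≤ Y → ∃ (𝔭 : Ideal (Literature.NumberTheory.Transcendental.Nesterenko.Rx m)) (β : Fin (m + 1) → ℂ), 𝔭.IsPrime ∧ 𝔭.IsHomogeneous (MvPolynomial.homogeneousSubmodule (Fin (m + 1)) ℚ) ∧ Literature.NumberTheory.Transcendental.Nesterenko.IsUnmixedOfRank 𝔭 1 ∧ β ∈ Literature.NumberTheory.Transcendental.Nesterenko.projZeros 𝔭 ∧ 1 ≤ Literature.NumberTheory.Transcendental.Nesterenko.ideg 𝔭 1 ∧ (Literature.NumberTheory.Transcendental.Nesterenko.ideg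 𝔭 1 : ℝ) ≤ (c * Δ) ^ t ∧ Literature.NumberTheory.Transcendental.Nesterenko.iheight 𝔭 1 ≤ c * Y * Δ ^ (t - 1) ∧ Literature.NumberTheory.Transcendental.Nesterenko.projDist (Fin.cons 1 θ) β ≤ Real.exp (-((Literature.NumberTheory.Transcendental.Nesterenko.iheight 𝔭 1 * Δ + Literature.NumberTheory.Transcendental.Nesterenko.ideg 𝔭 1 * Y) / c)) := by
  sorry

/-- **STUB 5 · `stub_currency`** (L, PROVABLE NOW — CURRENCY LIFTING, from Philippon's projective currency as
the panel demands, never per coordinate). Hypothesis: AP2 at `(1:θ)` in Nesterenko's currency for every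
`m ≥ 1`, `t ≥ 1`, `θ ∈ ℂ^m` with `trdeg ≤ t`; conclusion: the crux VERBATIM (its body; `ApproximationProperty`
is this `def`). THE WORK: given `ι`, `θ : ι → ℂ`, `t ≥ 1`, `trdeg ≤ t`: `ι = ∅` ⇒ `γ = θ`, `d = 1`, `H = 1`
(cf. Disproof `apAt_of_isEmpty`); else `e : ι ≃ Fin m`, `θ' = θ ∘ e.symm` (same adjoined field, `Set.range`
unchanged), take `c, 𝔭, β` from the hypothesis at scale `(Δ, Y)`; for `Δ ≥ c' ≥ 2c(1 + log(4‖(1:θ')‖²))` the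
accuracy makes `projDist·‖ω‖ ≤ 1/2`, so `β₀ ≠ 0` and `γᵢ := β_{(e i)+1}/β₀` has
`‖γ − θ‖ ≤ 2‖ω‖² projDist(ω, β)` (tree `affine_near_of_projDist_le`, PhilipponCriterionProjDist.lean);
DEGREE: the Chow form of the rank-1 prime `𝔭` is `a·∏_σ L_{σβ}` over the `deg 𝔭` conjugates
(`NesterenkoPhilippon2001_ch3_prop_4_4`, proved; tree `NesterenkoChowFormPrime*`), so `[ℚ(γ):ℚ] ≤ d := deg 𝔭`
and each `γᵢ` is algebraic of degree `≤ d`; HEIGHT: the primitive integer minimal polynomial `Pᵢ` of `γᵢ` has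
`log max|coeff| ≤ d log 2 + d·h_∞(γᵢ)… ≤ h(𝔭) + c_m·d` (Gelfond–Mahler for the linear factors of the Chow
form, tree `Roy2013.sum_mul_height_le_log_length` pattern / `Nesterenko.height` = `Height.logHeight`), and
`d ≤ (cΔ)^t ≤ c^t·Y·Δ^{t−1}` because `Δ ≤ Y` — so `log H ≤ (c + c_m c^t + log 2·c^t)·YΔ^{t−1}`; EXPONENT:
`log H·Δ + d·Y ≤ (h(𝔭) + k d)Δ + dY ≤ (k+1)(h(𝔭)Δ + dY)`, hence
`‖γ − θ‖ ≤ 2‖ω‖² exp(−(h(𝔭)Δ + deg 𝔭·Y)/c) ≤ exp(−(log H·Δ + d·Y)/c')` once `c' ≥ 2(k+1)c` and `Δ ≥ c'`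
(`Y ≥ Δ` kills `log 2‖ω‖²`); output `d`, `H`, `c'`. The constant depends on `θ` through `‖(1:θ)‖` and the
`c(θ)` of the hypothesis — exactly the dependence Disproof §2 (`approximationProperty_uniform_false`) forces;
`1 ≤ t` is used (Disproof §1). WHY IT MIGHT NEED RESHAPING: bookkeeping only (the degree/height dictionary
between a rank-1 prime's Chow form and the naive heights of the affine coordinates; if the tree's Chow-form
API lacks "zeros of a rank-1 prime = conjugates of one point", add `1 ≤ ideg`-style clauses to STUB 4's
output rather than weakening this stub). Leans on: `affine_near_of_projDist_le`, `one_le_norm_cons_one`,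
`NesterenkoPhilippon2001_ch3_prop_4_4` (+ `NesterenkoEliminationProp44Holds`), `Nesterenko.chowForm`,
`NesterenkoChowFormPrime`, `NesterenkoUResultantPointwise`, Mathlib `minpoly`, `IntermediateField.adjoin`,
`Polynomial.Monic`, `Height.logHeight`. [NesterenkoPhilippon2001 Ch. 3 §4 Def 4.5–4.6, Prop 4.4; LaurentRoy1999
p. 28 (taille vs naive height); Bugeaud2004 §8.3] -/
theorem stub_currency : (∀ (m t : ℕ) (θ : Fin m → ℂ), 1 ≤ m → 1 ≤ t → Algebra.trdeg ℚ ↥(IntermediateField.adjoin ℚ (Set.range θ)) ≤ (t : Cardinal) → ∃ c : ℝ, 1 ≤ c ∧ ∀ Δ Y : ℝ, c ≤ Δ → Δ ≤ Y → ∃ (𝔭 : Ideal (Literature.NumberTheory.Transcendental.Nesterenko.Rx m)) (β : Fin (m + 1) → ℂ), 𝔭.IsPrime ∧ 𝔭.IsHomogeneous (MvPolynomial.homogeneousSubmodule (Fin (m + 1)) ℚ) ∧ Literature.NumberTheory.Transcendental.Nesterenko.IsUnmixedOfRank 𝔭 1 ∧ β ∈ Literature.NumberTheory.Transcendental.Nesterenko.projZeros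 𝔭 ∧ 1 ≤ Literature.NumberTheory.Transcendental.Nesterenko.ideg 𝔭 1 ∧ (Literature.NumberTheory.Transcendental.Nesterenko.ideg 𝔭 1 : ℝ) ≤ (c * Δ) ^ t ∧ Literature.NumberTheory.Transcendental.Nesterenko.iheight 𝔭 1 ≤ c * Y * Δ ^ (t - 1) ∧ Literature.NumberTheory.Transcendental.Nesterenko.projDist (Fin.cons 1 θ) β ≤ Real.exp (-((Literature.NumberTheory.Transcendental.Nesterenko.iheight 𝔭 1 * Δ + Literature.NumberTheory.Transcendental.Nesterenko.ideg 𝔭 1 * Y) / c))) → ∀ (ι : Type) [Fintype ι] (θ : ι → ℂ) (t : ℕ), 1 ≤ t → Algebra.trdeg ℚ ↥(IntermediateField.adjoin ℚ (Set.range θ)) ≤ (t : Cardinal) → ∃ c : ℝ, 1 ≤ c ∧ ∀ Δ Y : ℝ, c ≤ Δ → Δ ≤ Y → ∃ (γ : ι → ℂ) (d H : ℕ), Module.finrank ℚ ↥(IntermediateField.adjoin ℚ (Set.range γ)) ≤ d ∧ (∀ i, ∃ P : Polynomial ℤ, P ≠ 0 ∧ P.natDegree ≤ d ∧ (∀ k,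 |P.coeff k| ≤ (H : ℤ)) ∧ Polynomial.aeval (γ i) P = 0) ∧ (d : ℝ) ≤ (c * Δ) ^ t ∧ Real.log H ≤ c * Y * Δ ^ (t - 1) ∧ ‖γ - θ‖ ≤ Real.exp (-((Real.log H * Δ + d * Y) / c)) := by
  sorry

/-! ## Consistency: each named statement IS its registered stub (definitionally) -/

theorem arithHilbertLB_holds : ArithHilbertLB := stub_arithHilbertLB
theorem geomHilbertLB_holds : GeomHilbertLB := stub_geomHilbertLB
theorem cycleAPOfLever_holds : CycleAPOfLever := stub_cycleAP_of_arithHilbertLB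
theorem extraction_holds : Extraction := stub_extraction
theorem currencyLifting_holds : CurrencyLifting := stub_currency

/-! ## Name-keyed aliases of the five statements (the hypotheses of the composition) -/
namespace Registered

/-- Alias of `ArithHilbertLB` keyed by the registered stub name. -/
abbrev stub_arithHilbertLB : Prop := ArithHilbertLB
/-- Alias of `GeomHilbertLB` keyed by the registered stub name. -/
abbrev stub_geomHilbertLB : Prop := GeomHilbertLB
/-- Alias of `CycleAPOfLever` keyed by the registered stub name. -/
abbrev stub_cycleAP_of_arithHilbertLB : Prop := CycleAPOfLever
/-- Alias of `Extraction` keyed by the registered stub name. -/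
abbrev stub_extraction : Prop := Extraction
/-- Alias of `CurrencyLifting` keyed by the registered stub name. -/
abbrev stub_currency : Prop := CurrencyLifting

end Registered

/-! ## Proved glue -/

/-- The REACH of the line without the foreign stub (kernel-checked): lever + geometric bound + template give
the 0-cycle approximation property with construction data at every point, every `t ≥ max(1, trdeg)`. -/
theorem cycleAP_of_lever (h₁ : Registered.stub_arithHilbertLB) (h₂ : Registered.stub_geomHilbertLB)
    (h₃ : Registered.stub_cycleAP_of_arithHilbertLB) :
    ∀ (m t : ℕ) (θ : Fin m → ℂ), 1 ≤ m → 1 ≤ t → TrdegLE m t θ → CycleAPAt m t θ :=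
  h₃ h₁ h₂

/-- … and with extraction, AP2 in Nesterenko's currency at every point. -/
theorem pointAP_of_lever (h₁ : Registered.stub_arithHilbertLB) (h₂ : Registered.stub_geomHilbertLB)
    (h₃ : Registered.stub_cycleAP_of_arithHilbertLB) (h₄ : Registered.stub_extraction) :
    ∀ (m t : ℕ) (θ : Fin m → ℂ), 1 ≤ m → 1 ≤ t → TrdegLE m t θ → PointAPAt m t θ :=
  fun m t θ hm ht htr => h₄ m t θ hm ht htr (cycleAP_of_lever h₁ h₂ h₃ m t θ hm ht htr)

/-! ## The composition: the five stubs imply the crux, by name -/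

/-- `ApproximationProperty` from the five stubs (pure logic; no `sorry`): the lever (STUB 1) and the geometric
bound (STUB 2) feed the arithmetic Philippon template (STUB 3) to give the 0-cycle property with construction
data at every `(1:θ)`; extraction (STUB 4) turns cycles into points; currency lifting (STUB 5) turns AP2 in
Nesterenko's currency into the typed crux, which is this conclusion by `rfl` (the crux is a `def`). -/
theorem ApproximationProperty_of (h₁ : Registered.stub_arithHilbertLB) (h₂ : Registered.stub_geomHilbertLB)
    (h₃ : Registered.stub_cycleAP_of_arithHilbertLB) (h₄ : Registered.stub_extraction)
    (h₅ : Registered.stub_currency) :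
    Summit.Schanuel.Schanuel.Theses.DiophantineDichotomy.ApproximationProperty :=
  h₅ (pointAP_of_lever h₁ h₂ h₃ h₄)

/-- Wiring check: the registered stubs feed `ApproximationProperty_of` as stated. -/
example : Summit.Schanuel.Schanuel.Theses.DiophantineDichotomy.ApproximationProperty :=
  ApproximationProperty_of stub_arithHilbertLB stub_geomHilbertLB stub_cycleAP_of_arithHilbertLB
    stub_extraction stub_currency

/-- The crux, pointwise-factored through this line's predicates (sanity: the consumer's view). -/
example (h : Summit.Schanuel.Schanuel.Theses.DiophantineDichotomy.ApproximationProperty) (θ : Fin 3 → ℂ)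
    (hθ : TrdegLE 3 3 θ) : ∃ c : ℝ, 1 ≤ c ∧ ∀ Δ Y : ℝ, c ≤ Δ → Δ ≤ Y → ∃ (γ : Fin 3 → ℂ) (d H : ℕ),
      Module.finrank ℚ ↥(IntermediateField.adjoin ℚ (Set.range γ)) ≤ d ∧
      (∀ i, ∃ P : Polynomial ℤ, P ≠ 0 ∧ P.natDegree ≤ d ∧ (∀ k, |P.coeff k| ≤ (H : ℤ)) ∧
        Polynomial.aeval (γ i) P = 0) ∧
      (d : ℝ) ≤ (c * Δ) ^ 3 ∧ Real.log H ≤ c * Y * Δ ^ (3 - 1) ∧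
      ‖γ - θ‖ ≤ Real.exp (-((Real.log H * Δ + d * Y) / c)) :=
  h (Fin 3) θ 3 (by norm_num) hθ

end Summit.Schanuel.Schanuel.Cruxes.ApproximationProperty.ArithmeticChardinPhilippon

end
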